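import Mathlib
import Summits.Ventures.PercRepro2.Defs
import Summits.Ventures.PercRepro2.Independence
import Summits.Ventures.PercRepro2.Harris
import Summits.Ventures.PercRepro2.Graph
import Summits.Ventures.PercRepro2.Events
import Summits.Ventures.PercRepro2.PartitionThree
import Summits.Ventures.PercRepro2.ZCTwoEdge
import Summits.Ventures.PercRepro2.ZCTwoEdgeGraph
import Summits.Ventures.PercRepro2.ZCA3TwoEdgeGraph
import Summits.Ventures.PercRepro2.ZCRootOW

/-!
# Theorem H on the graph (MINE-A.md §70.8): (ZC) when the root `a₁` has degree two with neighbours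
`o` and a non-mark `w`, from (ZC) on `G − a₁` for the marks `(w, a₃, o)`
(blind cell PercRepro2, mine-a g24)

`ends : E → Sym2 V`, `f₁ = a₁o`, `f₂ = a₁w` the only edges at the root `a₁`; `{a₁} ∉ 𝓔`.  With
`ω⁻ := ω[f₁, f₂ ↦ closed]` the structural lemmas of `ZCTwoEdgeGraph` (Theorem A) apply with `(o, w)` in
the place of `(a₃, o)`: `{a₁ ↔ o} = {f₁} ∪ ({f₂} ∩ {o ↔ w}⁻)`, `C(a₁) = {a₁} ∪ (C⁻(o) if f₁) ∪ (C⁻(w) if f₂)`;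
and `{a₁ ↔ a₃} = ({f₁} ∩ {o ↔ a₃}⁻) ∪ ({f₂} ∩ {w ↔ a₃}⁻)`, `{a₃ ↔ o} = {o ↔ a₃}⁻ ∪ ({a₁ ↔ a₃} ∩ {a₁ ↔ o})`
(off `{a₁ ↔ a₃}` the cluster of `a₃` is `C⁻(a₃)`, by the closure lemma `mem_cluster_closeTwo_of_conn`).
The abstract theorem `zc_rootow` applies with `A = {o ↔ a₃}⁻`, `W = {o ↔ w}⁻`, `Γ = {w ↔ a₃}⁻`,
`YK = {{a₁} ∪ C⁻(o) ∈ 𝓔}`, `YW = {{a₁} ∪ C⁻(w) ∈ 𝓔}`, `YB = {{a₁} ∪ C⁻(o) ∪ C⁻(w) ∈ 𝓔}`,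
`YX = {{a₁} ∪ C⁻(a₃) ∈ 𝓔}`, `YXK = {{a₁} ∪ C⁻(a₃) ∪ C⁻(o) ∈ 𝓔}`; lemma (P1) for `(o, a₃, w)` in `G − a₁` is
`partitionThree_lattice` under `p[f₁, f₂ ↦ 0]`, and the inductive hypothesis is literally (ZC) under
`p[f₁, f₂ ↦ 0]` for the marks `(w, a₃, o)` (the root moves to `w`) and the up-set `{S ∣ insert a₁ S ∈ 𝓔}`.

**Theorem** (`zc_rootow_graph`): (ZC)_{p[f₁,f₂↦0]}(w, a₃, o; 𝓔′) ≥ 0 ⇒ (ZC)_p(a₁, a₃, o; 𝓔) ≥ 0 — the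
root passes to its non-mark neighbour `w`.  One seat.
-/

namespace Summit.Ventures.PercRepro2

section GraphTheoremH

variable {V : Type*} {E : Type*} [Fintype E] [DecidableEq E] {R : Type*} [CommRing R]
  [LinearOrder R] [IsStrictOrderedRing R]

/-- **Theorem H on the graph (MINE-A.md §70.8).**  Bond percolation on a finite graph `(V, E, ends)`
whose root `a₁` is joined to the rest only by `f₁ = a₁o` and `f₂ = a₁w`; `𝓔` an up-set of vertex sets
with `{a₁} ∉ 𝓔`.  If (ZC) holds under `p[f₁, f₂ ↦ 0]` (the graph `G − a₁`) for the marks `(w, a₃, o)`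
and the up-set `{S ∣ insert a₁ S ∈ 𝓔}`, then (ZC) holds under `p` for the marks `(a₁, a₃, o)` and `𝓔`. -/
theorem zc_rootow_graph {p : E → R} (hp : IsProbVec p) {ends : E → Sym2 V} {a₁ a₃ o w : V}
    {f₁ f₂ : E} (hf : f₁ ≠ f₂) (hends₁ : ends f₁ = s(a₁, o)) (hends₂ : ends f₂ = s(a₁, w))
    (hroot : ∀ e, a₁ ∈ ends e → e = f₁ ∨ e = f₂) (h13 : a₁ ≠ a₃) (h1o : a₁ ≠ o)
    {𝓔 : Set (Set V)} (h𝓔 : IsUpperSet 𝓔) (h𝓔₁ : ({a₁} : Set V) ∉ 𝓔)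
    (hZ : let p' := Function.update (Function.update p f₁ 0) f₂ 0
      let 𝓔' : Set (Set V) := {S | insert a₁ S ∈ 𝓔}
      let e' := connEvent ends w a₃
      let L' := connEvent ends w o
      let U' := clusterInEvent ends w 𝓔'
      let γ' := connEvent ends a₃ o
      0 ≤ prob p' (e'ᶜ ∩ L'ᶜ ∩ γ'ᶜ) * (prob p' (U' ∩ (e' ∩ L')) - prob p' U' * prob p' (e' ∩ L'))
        - prob p' (e'ᶜ ∩ L'ᶜ ∩ γ') * (prob p' (U' ∩ (e' ∩ L'ᶜ)) - prob p' U' * prob p' (e' ∩ L'ᶜ))) :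
    let e := connEvent ends a₁ a₃
    let L := connEvent ends a₁ o
    let U := clusterInEvent ends a₁ 𝓔
    let γ := connEvent ends a₃ o
    0 ≤ prob p (eᶜ ∩ Lᶜ ∩ γᶜ) * (prob p (U ∩ (e ∩ L)) - prob p U * prob p (e ∩ L))
      - prob p (eᶜ ∩ Lᶜ ∩ γ) * (prob p (U ∩ (e ∩ Lᶜ)) - prob p U * prob p (e ∩ Lᶜ)) := by
  intro e L U γ
  simp only at hZ
  rw [connEvent_comm ends w o, connEvent_comm ends a₃ o] at hZ
  -- the events of `G − a₁`
  set A : Set (Config E) := {ω | Conn ends (Function.update (Function.update ω f₁ false) f₂ false) o a₃} with hAdef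
  set W : Set (Config E) := {ω | Conn ends (Function.update (Function.update ω f₁ false) f₂ false) o w} with hWdef
  set Γ : Set (Config E) := {ω | Conn ends (Function.update (Function.update ω f₁ false) f₂ false) w a₃} with hΓdef
  set YK : Set (Config E) := {ω | {a₁} ∪ cluster ends (Function.update (Function.update ω f₁ false) f₂ false) o ∈ 𝓔} with hYKdef
  set YW : Set (Config E) := {ω | {a₁} ∪ cluster ends (Function.update (Function.update ω f₁ false) f₂ false) w ∈ 𝓔} with hYWdef
  set YB : Set (Config E) := {ω | {a₁} ∪ cluster ends (Function.update (Function.update ω f₁ false) f₂ false) o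
      ∪ cluster ends (Function.update (Function.update ω f₁ false) f₂ false) w ∈ 𝓔} with hYBdef
  set YX : Set (Config E) := {ω | {a₁} ∪ cluster ends (Function.update (Function.update ω f₁ false) f₂ false) a₃ ∈ 𝓔} with hYXdef
  set YXK : Set (Config E) := {ω | {a₁} ∪ cluster ends (Function.update (Function.update ω f₁ false) f₂ false) a₃
      ∪ cluster ends (Function.update (Function.update ω f₁ false) f₂ false) o ∈ 𝓔} with hYXKdef
  -- the four graph events in the abstract form
  have hL : L = openEdge f₁ ∪ (openEdge f₂ ∩ W) := by
    ext ω
    simp only [L, W, Set.mem_union, Set.mem_inter_iff, Set.mem_setOf_eq, mem_connEvent,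
      mem_openEdge]
    exact conn_root_a3_iff hf hends₁ hends₂ hroot h1o ω
  have he' : ∀ ω : Config E, Conn ends ω a₁ a₃ ↔ (ω f₁ = true ∧ ω ∈ A) ∨ (ω f₂ = true ∧ ω ∈ Γ) := by
    intro ω
    have h := cluster_root_eq hf hends₁ hends₂ hroot ω
    have ho : a₃ ∈ cluster ends ω a₁ ↔ Conn ends ω a₁ a₃ := Iff.rfl
    rw [← ho, h]
    simp only [A, Γ, Set.mem_union, Set.mem_singleton_iff, Set.mem_setOf_eq, mem_cluster]
    constructor
    · rintro ((h | h) | h)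
      · exact absurd h.symm h13
      · exact Or.inl h
      · exact Or.inr h
    · rintro (h | h)
      · exact Or.inl (Or.inr h)
      · exact Or.inr h
  have he : e = (openEdge f₁ ∩ A) ∪ (openEdge f₂ ∩ Γ) := by
    ext ω
    simp only [e, Set.mem_union, Set.mem_inter_iff, mem_connEvent, mem_openEdge]
    exact he' ω
  have hγ : γ = A ∪ (e ∩ L) := by
    ext ω
    simp only [γ, A, e, L, Set.mem_union, Set.mem_inter_iff, Set.mem_setOf_eq, mem_connEvent]
    constructor
    · intro hc
      by_cases h3 : Conn ends ω a₁ a₃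
      · exact Or.inr ⟨h3, conn_trans h3 hc⟩
      · left
        -- off `{a₁ ↔ a₃}` the cluster of `a₃` is closed in `ω⁻`
        have ho : o ∈ cluster ends (Function.update (Function.update ω f₁ false) f₂ false) a₃ := by
          refine mem_cluster_closeTwo_of_conn hf hends₁ hends₂ hroot (Ne.symm h13) ?_ ?_ hc
          · intro hf1 hoc
            exact h3 (conn_symm (conn_trans (conn_mono (closeTwo_le f₁ f₂ ω) hoc)
              (conn_symm (conn_of_openAdj ⟨f₁, hf1, hends₁⟩))))
          · intro hf2 hwc
            exact h3 (conn_symm (conn_trans (conn_mono (closeTwo_le f₁ f₂ ω) hwc)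
              (conn_symm (conn_of_openAdj ⟨f₂, hf2, hends₂⟩))))
        exact conn_symm ho
    · rintro (h | ⟨h3, hc⟩)
      · exact conn_symm (conn_mono (closeTwo_le f₁ f₂ ω) h)
      · exact conn_trans (conn_symm h3) hc
  have hU : U = (openEdge f₁ ∩ closedEdge f₂ ∩ YK) ∪ (closedEdge f₁ ∩ openEdge f₂ ∩ YW)
      ∪ (openEdge f₁ ∩ openEdge f₂ ∩ YB) := by
    ext ω
    simp only [U, YK, YW, YB, Set.mem_union, Set.mem_inter_iff, Set.mem_setOf_eq,
      mem_clusterInEvent, mem_openEdge, mem_closedEdge]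
    rw [cluster_root_eq hf hends₁ hends₂ hroot ω]
    rcases Bool.eq_false_or_eq_true (ω f₁) with hf1 | hf1 <;>
      rcases Bool.eq_false_or_eq_true (ω f₂) with hf2 | hf2 <;>
      simp [hf1, hf2, h𝓔₁] <;> rfl
  -- the hypotheses of the abstract theorem: invariance under forcing `f₁`, `f₂`
  have hA : ∀ (ω : Config E) (b₁ b₂ : Bool),
      Function.update (Function.update ω f₁ b₁) f₂ b₂ ∈ A ↔ ω ∈ A := by
    intro ω b₁ b₂; simp only [A, Set.mem_setOf_eq, closeTwo_update]
  have hW : ∀ (ω : Config E) (b₁ b₂ : Bool),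
      Function.update (Function.update ω f₁ b₁) f₂ b₂ ∈ W ↔ ω ∈ W := by
    intro ω b₁ b₂; simp only [W, Set.mem_setOf_eq, closeTwo_update]
  have hΓ : ∀ (ω : Config E) (b₁ b₂ : Bool),
      Function.update (Function.update ω f₁ b₁) f₂ b₂ ∈ Γ ↔ ω ∈ Γ := by
    intro ω b₁ b₂; simp only [Γ, Set.mem_setOf_eq, closeTwo_update]
  have hYK : ∀ (ω : Config E) (b₁ b₂ : Bool),
      Function.update (Function.update ω f₁ b₁) f₂ b₂ ∈ YK ↔ ω ∈ YK := by
    intro ω b₁ b₂; simp only [YK, Set.mem_setOf_eq, closeTwo_update]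
  have hYW : ∀ (ω : Config E) (b₁ b₂ : Bool),
      Function.update (Function.update ω f₁ b₁) f₂ b₂ ∈ YW ↔ ω ∈ YW := by
    intro ω b₁ b₂; simp only [YW, Set.mem_setOf_eq, closeTwo_update]
  have hYB : ∀ (ω : Config E) (b₁ b₂ : Bool),
      Function.update (Function.update ω f₁ b₁) f₂ b₂ ∈ YB ↔ ω ∈ YB := by
    intro ω b₁ b₂; simp only [YB, Set.mem_setOf_eq, closeTwo_update]
  -- increasing
  have hAup : IsUpperSet A := fun ω ω' hle hω => conn_mono (closeTwo_mono f₁ f₂ hle) hω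
  have hWup : IsUpperSet W := fun ω ω' hle hω => conn_mono (closeTwo_mono f₁ f₂ hle) hω
  have hΓup : IsUpperSet Γ := fun ω ω' hle hω => conn_mono (closeTwo_mono f₁ f₂ hle) hω
  have hYKup : IsUpperSet YK := fun ω ω' hle hω =>
    h𝓔 (Set.union_subset_union_right _ (cluster_mono (closeTwo_mono f₁ f₂ hle) o)) hω
  have hYWup : IsUpperSet YW := fun ω ω' hle hω =>
    h𝓔 (Set.union_subset_union_right _ (cluster_mono (closeTwo_mono f₁ f₂ hle) w)) hω
  have hYBup : IsUpperSet YB := fun ω ω' hle hω =>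
    h𝓔 (Set.union_subset_union (Set.union_subset_union_right _
      (cluster_mono (closeTwo_mono f₁ f₂ hle) o)) (cluster_mono (closeTwo_mono f₁ f₂ hle) w)) hω
  have hYXup : IsUpperSet YX := fun ω ω' hle hω =>
    h𝓔 (Set.union_subset_union_right _ (cluster_mono (closeTwo_mono f₁ f₂ hle) a₃)) hω
  have hYXKup : IsUpperSet YXK := fun ω ω' hle hω =>
    h𝓔 (Set.union_subset_union (Set.union_subset_union_right _
      (cluster_mono (closeTwo_mono f₁ f₂ hle) a₃)) (cluster_mono (closeTwo_mono f₁ f₂ hle) o)) hω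
  -- transitivity in `G − a₁`
  have hWΓ : ∀ ω, ω ∈ W → ω ∈ Γ → ω ∈ A := fun ω hw hγ => conn_trans hw hγ
  have hAW : ∀ ω, ω ∈ A → ω ∈ W → ω ∈ Γ := fun ω ha hw => conn_trans (conn_symm hw) ha
  have hAΓ : ∀ ω, ω ∈ A → ω ∈ Γ → ω ∈ W := fun ω ha hγ => conn_trans ha (conn_symm hγ)
  -- the cluster events
  have hKB : YK ⊆ YB := fun ω hω => h𝓔 Set.subset_union_left hω
  have hWB : YW ⊆ YB := fun ω hω =>
    h𝓔 (Set.union_subset_union Set.subset_union_left le_rfl) hω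
  have hKXK : YK ⊆ YXK := fun ω hω =>
    h𝓔 (Set.union_subset_union Set.subset_union_left le_rfl) hω
  have hKW : YK ∩ W = YW ∩ W := by
    ext ω
    simp only [YK, YW, W, Set.mem_inter_iff, Set.mem_setOf_eq]
    constructor
    · rintro ⟨h, hc⟩
      refine ⟨?_, hc⟩
      rw [← cluster_eq_of_conn hc]; exact h
    · rintro ⟨h, hc⟩
      refine ⟨?_, hc⟩
      rw [← cluster_eq_of_conn hc] at h; exact h
  have hWBW : YW ∩ W = YB ∩ W := by
    ext ω
    simp only [YW, YB, W, Set.mem_inter_iff, Set.mem_setOf_eq]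
    constructor
    · rintro ⟨h, hc⟩
      refine ⟨?_, hc⟩
      rw [cluster_eq_of_conn hc, Set.union_assoc, Set.union_self]; exact h
    · rintro ⟨h, hc⟩
      refine ⟨?_, hc⟩
      rw [cluster_eq_of_conn hc, Set.union_assoc, Set.union_self] at h; exact h
  have hXA : YX ∩ A = YK ∩ A := by
    ext ω
    simp only [YX, YK, A, Set.mem_inter_iff, Set.mem_setOf_eq]
    constructor
    · rintro ⟨h, hc⟩
      refine ⟨?_, hc⟩
      rw [cluster_eq_of_conn hc]; exact h
    · rintro ⟨h, hc⟩
      refine ⟨?_, hc⟩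
      rw [cluster_eq_of_conn hc] at h; exact h
  have hXKA : YXK ∩ A = YK ∩ A := by
    ext ω
    simp only [YXK, YK, A, Set.mem_inter_iff, Set.mem_setOf_eq]
    constructor
    · rintro ⟨h, hc⟩
      refine ⟨?_, hc⟩
      rw [← cluster_eq_of_conn hc, Set.union_assoc, Set.union_self] at h; exact h
    · rintro ⟨h, hc⟩
      refine ⟨?_, hc⟩
      rw [← cluster_eq_of_conn hc, Set.union_assoc, Set.union_self]; exact h
  have hXΓ : YX ∩ Γ = YW ∩ Γ := by
    ext ω
    simp only [YX, YW, Γ, Set.mem_inter_iff, Set.mem_setOf_eq]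
    constructor
    · rintro ⟨h, hc⟩
      refine ⟨?_, hc⟩
      rw [cluster_eq_of_conn hc]; exact h
    · rintro ⟨h, hc⟩
      refine ⟨?_, hc⟩
      rw [cluster_eq_of_conn hc] at h; exact h
  have hXKΓ : YXK ∩ Γ = YB ∩ Γ := by
    ext ω
    simp only [YXK, YB, Γ, Set.mem_inter_iff, Set.mem_setOf_eq]
    constructor
    · rintro ⟨h, hc⟩
      refine ⟨?_, hc⟩
      rw [← cluster_eq_of_conn hc, Set.union_right_comm] at h; exact h
    · rintro ⟨h, hc⟩
      refine ⟨?_, hc⟩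
      rw [← cluster_eq_of_conn hc, Set.union_right_comm]; exact h
  -- the shift `P_{p[f₁,f₂↦0]}(S) = P_p({ω ∣ ω⁻ ∈ S})`
  have shift : ∀ S : Set (Config E), prob (Function.update (Function.update p f₁ 0) f₂ 0) S
      = prob p {ω | Function.update (Function.update ω f₁ false) f₂ false ∈ S} := by
    intro S
    rw [prob_update_zero_eq_shift, prob_update_zero_eq_shift]
    rfl
  have hp' : IsProbVec (Function.update (Function.update p f₁ 0) f₂ 0) :=
    (hp.update f₁ le_rfl zero_le_one).update f₂ le_rfl zero_le_one
  -- lemma (P1) for the marks `(o, a₃, w)` in `G − a₁`, middle vertex `a₃`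
  have hP1 : prob p (A ∩ Wᶜ) * prob p (Aᶜ ∩ Wᶜ ∩ Γ) ≤ prob p (A ∩ W) * prob p (Aᶜ ∩ Wᶜ ∩ Γᶜ) := by
    have h := partitionThree_lattice hp' ends o a₃ w
    rw [shift, shift, shift, shift] at h
    have e1 : {ω : Config E | Function.update (Function.update ω f₁ false) f₂ false ∈ partABc ends o a₃ w}
        = A ∩ Wᶜ := by
      ext ω
      simp only [partABc, A, W, Set.mem_setOf_eq, Set.mem_inter_iff, Set.mem_compl_iff, mem_connEvent]
    have e2 : {ω : Config E | Function.update (Function.update ω f₁ false) f₂ false ∈ partBCa ends o a₃ w}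
        = Aᶜ ∩ Wᶜ ∩ Γ := by
      ext ω
      simp only [partBCa, A, W, Γ, Set.mem_setOf_eq, Set.mem_inter_iff, Set.mem_compl_iff, mem_connEvent]
      constructor
      · rintro ⟨h1, h2⟩; exact ⟨⟨h2, fun hw => h2 (conn_trans hw (conn_symm h1))⟩, conn_symm h1⟩
      · rintro ⟨⟨h2, _⟩, h1⟩; exact ⟨conn_symm h1, h2⟩
    have e3 : {ω : Config E | Function.update (Function.update ω f₁ false) f₂ false ∈ partAll ends o a₃ w}
        = A ∩ W := by
      ext ω
      simp only [partAll, A, W, Set.mem_setOf_eq, Set.mem_inter_iff, mem_connEvent]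
      constructor
      · rintro ⟨h1, h2⟩; exact ⟨h1, conn_trans h1 h2⟩
      · rintro ⟨h1, h2⟩; exact ⟨h1, conn_trans (conn_symm h1) h2⟩
    have e4 : {ω : Config E | Function.update (Function.update ω f₁ false) f₂ false ∈ partApart ends o a₃ w}
        = Aᶜ ∩ Wᶜ ∩ Γᶜ := by
      ext ω
      simp only [partApart, A, W, Γ, Set.mem_setOf_eq, Set.mem_inter_iff, Set.mem_compl_iff,
        mem_connEvent]
      constructor
      · rintro ⟨⟨h1, h2⟩, h3⟩; exact ⟨⟨h1, h2⟩, fun h => h3 (conn_symm h)⟩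
      · rintro ⟨⟨h1, h2⟩, h3⟩; exact ⟨⟨h1, h2⟩, fun h => h3 (conn_symm h)⟩
    rw [e1, e2, e3, e4] at h
    exact h
  -- the inductive hypothesis in the abstract form
  have hZC : 0 ≤ prob p (Γᶜ ∩ Wᶜ ∩ Aᶜ) * (prob p (YW ∩ (Γ ∩ W)) - prob p YW * prob p (Γ ∩ W))
      - prob p (Γᶜ ∩ Wᶜ ∩ A) * (prob p (YW ∩ (Γ ∩ Wᶜ)) - prob p YW * prob p (Γ ∩ Wᶜ)) := by
    simp only [shift] at hZ
    have s1 : {ω : Config E | Function.update (Function.update ω f₁ false) f₂ false ∈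
        (connEvent ends w a₃)ᶜ ∩ (connEvent ends o w)ᶜ ∩ (connEvent ends o a₃)ᶜ} = Γᶜ ∩ Wᶜ ∩ Aᶜ := by
      ext ω; simp only [A, W, Γ, Set.mem_setOf_eq, Set.mem_inter_iff, Set.mem_compl_iff, mem_connEvent]
    have s2 : {ω : Config E | Function.update (Function.update ω f₁ false) f₂ false ∈
        clusterInEvent ends w {S | insert a₁ S ∈ 𝓔} ∩ (connEvent ends w a₃ ∩ connEvent ends o w)}
        = YW ∩ (Γ ∩ W) := by
      ext ω
      simp only [YW, W, Γ, Set.mem_setOf_eq, Set.mem_inter_iff, mem_connEvent, mem_clusterInEvent,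
        Set.insert_eq]
    have s3 : {ω : Config E | Function.update (Function.update ω f₁ false) f₂ false ∈
        clusterInEvent ends w {S | insert a₁ S ∈ 𝓔}} = YW := by
      ext ω
      simp only [YW, Set.mem_setOf_eq, mem_clusterInEvent, Set.insert_eq]
    have s4 : {ω : Config E | Function.update (Function.update ω f₁ false) f₂ false ∈
        connEvent ends w a₃ ∩ connEvent ends o w} = Γ ∩ W := by
      ext ω; simp only [W, Γ, Set.mem_setOf_eq, Set.mem_inter_iff, mem_connEvent]
    have s5 : {ω : Config E | Function.update (Function.update ω f₁ false) f₂ false ∈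
        (connEvent ends w a₃)ᶜ ∩ (connEvent ends o w)ᶜ ∩ connEvent ends o a₃} = Γᶜ ∩ Wᶜ ∩ A := by
      ext ω; simp only [A, W, Γ, Set.mem_setOf_eq, Set.mem_inter_iff, Set.mem_compl_iff, mem_connEvent]
    have s6 : {ω : Config E | Function.update (Function.update ω f₁ false) f₂ false ∈
        clusterInEvent ends w {S | insert a₁ S ∈ 𝓔} ∩ (connEvent ends w a₃ ∩ (connEvent ends o w)ᶜ)}
        = YW ∩ (Γ ∩ Wᶜ) := by
      ext ω
      simp only [YW, W, Γ, Set.mem_setOf_eq, Set.mem_inter_iff, Set.mem_compl_iff, mem_connEvent,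
        mem_clusterInEvent, Set.insert_eq]
    have s7 : {ω : Config E | Function.update (Function.update ω f₁ false) f₂ false ∈
        connEvent ends w a₃ ∩ (connEvent ends o w)ᶜ} = Γ ∩ Wᶜ := by
      ext ω; simp only [W, Γ, Set.mem_setOf_eq, Set.mem_inter_iff, Set.mem_compl_iff, mem_connEvent]
    rw [s1, s2, s3, s4, s5, s6, s7] at hZ
    exact hZ
  have key := zc_rootow hp hf hA hW hΓ hYK hYW hYB hAup hWup hΓup hYKup hYWup hYBup hYXup hYXKup
    hWΓ hAW hAΓ hKB hWB hKXK hKW hWBW hXA hXKA hXΓ hXKΓ hP1 hZC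
  simp only at key
  rw [hγ, hU, he, hL]
  exact key

end GraphTheoremH

end Summit.Ventures.PercRepro2
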